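import Summits.CriticalPhenomena.CardyFormulaZ2.Theses.CardySusyWard
import Literature.Probability.LatticeModels.MedialExplorationChains
import Literature.Probability.Process.KolmogorovExtensionProofs

/-!
# `ParafermionFamiliesToSLESix` (route `CardySusyWard`, stmt-CriticalPhenomena-10814): the
# conclusion's eventual-admissibility side condition is load-bearing

Negative-side support (cdisprove unit, cycle 1). The conclusion of the crux — SLE₆ convergence of
the re-oriented medial exploration interface for every Dobrushin domain and every family `Λ` of
discrete Dobrushin data with the right carrier and mesh, arcs and marks converging, admissible for
all small meshes — becomes FALSE when eventual admissibility (with the dual-arc and marks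
convergence) is dropped (`conclusion_false_without_admissibility`): on the unit disc the data with
wired arc `(ab)` and "dual-wired arc" the far point `{1000}` have an empty discrete
arc `B` (`farArcData_zdArcB`), hence no `A`–`B` edge, hence no exploration path
(`medialExploration_farArcData`), so the interface functional is the junk constant curve `0`
(`target_iface_farArcData`), and a law with a deterministic endpoint `≠ b` never converges to
chordal SLE_κ in `(D; a, b)` (`not_convergesInLawToSLE_of_target_eq`: an SLE curve ends at `b`
almost surely, `target_ae_of_isSLECurve`; the endpoint functional is `1`-Lipschitz on
`CurveClass ℂ`; the pre-Wiener measure is a probability measure). Lessons for the provers: the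
conclusion cannot be closed by junk, and any proof must use eventual admissibility of the family.
-/

noncomputable section

namespace Summit.CriticalPhenomena.CardyFormulaZ2.Theorems.ParafermionFamiliesToSLESix.Negative

open scoped Topology NNReal unitInterval
open Filter MeasureTheory Set
open Literature.Probability.LatticeModels Literature.Probability.Percolation
open Literature.Probability.RandomPlanarGeometry
open Summit.CriticalPhenomena.CardyFormulaZ2.Theses.CardySusyWard

/-! ### The far-arc junk data on the unit disc

At mesh `δ`: `⟨𝔻, δ, (ab), {1000}⟩` — wired arc the upper half circle `(ab)`, "dual-wired arc" the
far point `1000` (written as a structure literal throughout; no definition is introduced). -/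

/-- The discrete dual-wired arc of the far-arc data is empty: every site of `Ω_δ` is within `2`
of the boundary point `1 ∈ ∂𝔻 ∖ {1000}` and farther than `999` from `1000`. [folklore] -/
theorem farArcData_zdArcB (δ : ℝ) : (⟨Metric.ball (0:ℂ) 1, δ, DobrushinDomain.unitDisc.arc 0, {(1000:ℂ)}⟩ : DiscreteDobrushin).zdArcB = ∅ := by
  ext x
  simp only [Set.mem_empty_iff_false, iff_false]
  intro hx
  have hx' : x ∈ (⟨Metric.ball (0:ℂ) 1, δ, DobrushinDomain.unitDisc.arc 0, {(1000:ℂ)}⟩ : DiscreteDobrushin).zdDiscreteArc {(1000:ℂ)} := hx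
  rw [DiscreteDobrushin.mem_zdDiscreteArc_iff] at hx'
  obtain ⟨hxb, hle⟩ := hx'
  simp only [Metric.infDist_singleton] at hle
  have hxΩ : meshPoint δ x ∈ Metric.ball (0:ℂ) 1 :=
    meshDomain_subset_meshVertices _ _ ((⟨Metric.ball (0:ℂ) 1, δ, DobrushinDomain.unitDisc.arc 0, {(1000:ℂ)}⟩ : DiscreteDobrushin).zdBoundary_subset_meshDomain hxb)
  have hp : ‖meshPoint δ x‖ < 1 := by simpa using hxΩ
  have h1 : (1:ℂ) ∈ frontier (Metric.ball (0:ℂ) 1) \ {(1000:ℂ)} := by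
    refine ⟨?_, by norm_num⟩
    rw [frontier_ball (0:ℂ) one_ne_zero]
    simp
  have h2 : Metric.infDist (meshPoint δ x) (frontier (Metric.ball (0:ℂ) 1) \ {(1000:ℂ)}) ≤
      dist (meshPoint δ x) 1 := Metric.infDist_le_dist_of_mem h1
  have h3 : dist (meshPoint δ x) (1:ℂ) ≤ ‖meshPoint δ x‖ + ‖(1:ℂ)‖ := by
    rw [dist_eq_norm]; exact norm_sub_le _ _
  have h4 : ‖(1000:ℂ)‖ - ‖meshPoint δ x‖ ≤ dist (meshPoint δ x) (1000:ℂ) := by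
    rw [dist_comm, dist_eq_norm]; exact norm_sub_norm_le _ _
  have h5 : ‖(1000:ℂ)‖ = 1000 := by
    rw [show (1000:ℂ) = ((1000:ℝ) : ℂ) by norm_num, Complex.norm_real]; norm_num
  rw [h5] at h4
  rw [norm_one] at h3
  change dist (meshPoint δ x) 1000 ≤
    Metric.infDist (meshPoint δ x) (frontier (Metric.ball (0:ℂ) 1) \ {(1000:ℂ)}) at hle
  linarith

/-- Hence the far-arc data have no `A`–`B` edge. [folklore] -/
theorem farArcData_zdABEdges (δ : ℝ) : (⟨Metric.ball (0:ℂ) 1, δ, DobrushinDomain.unitDisc.arc 0, {(1000:ℂ)}⟩ : DiscreteDobrushin).zdABEdges = ∅ := by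
  ext e
  simp [DiscreteDobrushin.mem_zdABEdges_iff, farArcData_zdArcB]

/-- Hence no exploration path: `medialExploration` is the junk value `[]`. [folklore] -/
theorem medialExploration_farArcData (δ : ℝ) (ω : BondConfig (Site 2)) :
    medialExploration (⟨Metric.ball (0:ℂ) 1, δ, DobrushinDomain.unitDisc.arc 0, {(1000:ℂ)}⟩ : DiscreteDobrushin) ω = [] := by
  rcases medialExploration_eq_nil_or (⟨Metric.ball (0:ℂ) 1, δ, DobrushinDomain.unitDisc.arc 0, {(1000:ℂ)}⟩ : DiscreteDobrushin) ω with h | h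
  · exact h
  · exfalso
    have := h.head_mem
    rw [farArcData_zdABEdges] at this
    exact this

/-- Hence the exploration curve is the junk constant curve `0`. [folklore] -/
theorem medialExplorationCurve_farArcData (δ : ℝ) (ω : BondConfig (Site 2)) :
    medialExplorationCurve (⟨Metric.ball (0:ℂ) 1, δ, DobrushinDomain.unitDisc.arc 0, {(1000:ℂ)}⟩ : DiscreteDobrushin) ω = ContinuousMap.const _ 0 := by
  rw [medialExplorationCurve, medialExploration_farArcData, List.map_nil, polyline_nil]

/-- Hence the interface functional of the conclusion (written verbatim) ends at `0`, for every
mesh and every configuration. [folklore] -/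
theorem target_iface_farArcData (δ : ℝ) (ω : BondConfig (Site 2)) :
    (CurveClass.mk
      (if dist (medialExplorationCurve (⟨Metric.ball (0:ℂ) 1, δ, DobrushinDomain.unitDisc.arc 0, {(1000:ℂ)}⟩ : DiscreteDobrushin) ω 0) (DobrushinDomain.unitDisc.pt 0) ≤
          dist (medialExplorationCurve (⟨Metric.ball (0:ℂ) 1, δ, DobrushinDomain.unitDisc.arc 0, {(1000:ℂ)}⟩ : DiscreteDobrushin) ω 0) (DobrushinDomain.unitDisc.pt 1)
        then (⟨medialExplorationCurve (⟨Metric.ball (0:ℂ) 1, δ, DobrushinDomain.unitDisc.arc 0, {(1000:ℂ)}⟩ : DiscreteDobrushin) ω⟩ : Curve ℂ)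
        else ⟨(medialExplorationCurve (⟨Metric.ball (0:ℂ) 1, δ, DobrushinDomain.unitDisc.arc 0, {(1000:ℂ)}⟩ : DiscreteDobrushin) ω).comp
          ⟨unitInterval.symm, unitInterval.continuous_symm⟩⟩)).target = 0 := by
  rw [medialExplorationCurve_farArcData]
  split_ifs <;> rfl

/-- The pre-Wiener measure is a probability measure (Kolmogorov extension, proved in the tree). [folklore] -/
theorem isProbabilityMeasure_preWiener :
    IsProbabilityMeasure Literature.Probability.Process.preWienerMeasure :=
  Literature.Probability.Process.isProbabilityMeasure_preWienerMeasure
    (Literature.Probability.Process.isProjectiveLimit_preWienerMeasure_of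
      Literature.Probability.Process.exists_isProjectiveLimit_holds)

/-- An SLE_κ random curve in `(D; a, b)` ends at `b` almost surely (the compactified image is
pinned to `b` at time `1`). [cite: Lawler2005, §6.3] -/
theorem target_ae_of_isSLECurve {κ : ℝ≥0} {D : DobrushinDomain} {Γ : (ℝ≥0 → ℝ) → CurveClass ℂ}
    (h : IsSLECurve κ D Γ) :
    ∀ᵐ ω ∂Literature.Probability.Process.preWienerMeasure, (Γ ω).target = D.pt 1 := by
  obtain ⟨-, φ, -, hae⟩ := h
  filter_upwards [hae] with ω hω
  obtain ⟨-, c, hc, hcomp⟩ := hω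
  rw [hc, CurveClass.target_mk]
  exact hcomp.2

/-- **`ConvergesInLawToSLE` has teeth**: it fails whenever the interfaces have, at every positive
mesh, a deterministic endpoint different from `b` (test function `min 1 (dist (target ·) t₀)`,
endpoint functional `1`-Lipschitz, SLE curve ends at `b` a.s., pre-Wiener measure a probability
measure). [folklore] -/
theorem not_convergesInLawToSLE_of_target_eq {Ωδ : ℝ → Type*} [∀ δ, MeasurableSpace (Ωδ δ)]
    {X : ∀ δ, Ωδ δ → CurveClass ℂ} {P : ∀ δ, Measure (Ωδ δ)} [∀ δ, IsProbabilityMeasure (P δ)]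
    {κ : ℝ≥0} {D : DobrushinDomain} {t₀ : ℂ} (ht : t₀ ≠ D.pt 1)
    (hX : ∀ δ, 0 < δ → ∀ ω, (X δ ω).target = t₀) : ¬ ConvergesInLawToSLE κ D X P := by
  rintro ⟨Γ, hΓ, -, hlaw⟩
  haveI := isProbabilityMeasure_preWiener
  have hcont : Continuous fun q : CurveClass ℂ => min 1 (dist q.target t₀) :=
    continuous_const.min (CurveClass.lipschitzWith_target.continuous.dist continuous_const)
  have hbd : ∀ p q : CurveClass ℂ,
      dist ((⟨_, hcont⟩ : C(CurveClass ℂ, ℝ)) p) ((⟨_, hcont⟩ : C(CurveClass ℂ, ℝ)) q) ≤ 1 := by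
    intro p q
    simp only [ContinuousMap.coe_mk, Real.dist_eq]
    have hp0 : 0 ≤ min 1 (dist p.target t₀) := le_min zero_le_one dist_nonneg
    have hp1 : min 1 (dist p.target t₀) ≤ 1 := min_le_left _ _
    have hq0 : 0 ≤ min 1 (dist q.target t₀) := le_min zero_le_one dist_nonneg
    have hq1 : min 1 (dist q.target t₀) ≤ 1 := min_le_left _ _
    rw [abs_le]; constructor <;> linarith
  set g : BoundedContinuousFunction (CurveClass ℂ) ℝ :=
    BoundedContinuousFunction.mkOfBound ⟨_, hcont⟩ 1 hbd with hg
  have hgap : ∀ q : CurveClass ℂ, g q = min 1 (dist q.target t₀) := fun q => rfl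
  -- lattice side: the integrals vanish at every positive mesh
  have h1 : ∀ δ, 0 < δ → ∫ ω, g (X δ ω) ∂P δ = 0 := by
    intro δ hδ
    simp [hgap, hX δ hδ]
  -- SLE side: the integral is the positive constant `m`
  set m : ℝ := min 1 (dist (D.pt 1) t₀) with hm
  have hmpos : 0 < m := lt_min one_pos (dist_pos.2 ht.symm)
  have h2 : ∫ ω, g (Γ ω) ∂Literature.Probability.Process.preWienerMeasure = m := by
    have hae : (fun ω => g (Γ ω)) =ᵐ[Literature.Probability.Process.preWienerMeasure] fun _ => m := by
      filter_upwards [target_ae_of_isSLECurve hΓ] with ω hω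
      rw [hgap, hω]
    rw [integral_congr_ae hae]
    simp
  have h3 : Tendsto (fun δ : ℝ => ∫ ω, g (X δ ω) ∂P δ) (𝓝[>] (0:ℝ)) (𝓝 m) := h2 ▸ hlaw g
  have h4 : Tendsto (fun _ : ℝ => (0:ℝ)) (𝓝[>] (0:ℝ)) (𝓝 m) :=
    h3.congr' (eventually_nhdsWithin_of_forall fun δ hδ => h1 δ hδ)
  have h5 : m = 0 := tendsto_nhds_unique h4 tendsto_const_nhds
  exact hmpos.ne' h5

/-- `b = -1 ≠ 0` for the library's unit-disc Dobrushin domain (its marked points lie on the unit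
circle). [folklore] -/
theorem unitDisc_pt_one_ne_zero : DobrushinDomain.unitDisc.pt 1 ≠ 0 := by
  have h := DobrushinDomain.unitDisc.pt_mem_frontier 1
  change DobrushinDomain.unitDisc.pt 1 ∈ frontier (Metric.ball (0:ℂ) 1) at h
  rw [frontier_ball (0:ℂ) one_ne_zero] at h
  intro h0
  rw [h0] at h
  simp at h

/-- **Eventual admissibility is load-bearing for the conclusion**: with only the carrier, mesh
and wired-arc conditions kept (dual-arc convergence, marks convergence and eventual admissibility
dropped) the conclusion of the crux is FALSE — witness the far-arc junk family on the unit disc.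
The interface functional is written verbatim as in the crux. [folklore] -/
theorem conclusion_false_without_admissibility :
    ¬ ∀ (D : DobrushinDomain) (Λ : ℝ → DiscreteDobrushin), (∀ δ, (Λ δ).Ω = D.carrier) →
        (∀ δ, (Λ δ).δ = δ) →
        Tendsto (fun δ : ℝ => Metric.hausdorffEDist (Λ δ).arcA (D.arc 0)) (𝓝[>] (0:ℝ)) (𝓝 0) →
        ConvergesInLawToSLE 6 D (Ωδ := fun _ => BondConfig (Site 2))
          (fun δ ω => CurveClass.mk
            (if dist (medialExplorationCurve (Λ δ) ω 0) (D.pt 0) ≤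
                dist (medialExplorationCurve (Λ δ) ω 0) (D.pt 1)
              then (⟨medialExplorationCurve (Λ δ) ω⟩ : Curve ℂ)
              else ⟨(medialExplorationCurve (Λ δ) ω).comp
                ⟨unitInterval.symm, unitInterval.continuous_symm⟩⟩))
          (fun _ => bondPercolation (zdGraph 2) half) := by
  intro h
  have key := h DobrushinDomain.unitDisc
    (fun δ : ℝ => (⟨Metric.ball (0:ℂ) 1, δ, DobrushinDomain.unitDisc.arc 0, {(1000:ℂ)}⟩ : DiscreteDobrushin)) (fun _ => rfl) (fun _ => rfl) (by
    simp only [Metric.hausdorffEDist_self]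
    exact tendsto_const_nhds)
  exact not_convergesInLawToSLE_of_target_eq (t₀ := 0) unitDisc_pt_one_ne_zero.symm
    (fun δ _ ω => target_iface_farArcData δ ω) key

end Summit.CriticalPhenomena.CardyFormulaZ2.Theorems.ParafermionFamiliesToSLESix.Negative
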